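import Literature.Analysis.FluidPDE.EnergySpaceRellich

/-!
# Sobolev-condensate no-go for `TwoAndHalfD.TwohalfdThesis` (stmt-AnomalousDissipation-0206), stub SC-RL:
# Rellich's lemma on plain `L²(T²; ℝ²)`

Crux `TwohalfdThesis` (= X), line `Sketch`, lead c7, section N of the skeleton (Sobolev condensates).  For
`B ∈ ℝ` and `G < ∞` the set

  `K = {w ∈ L²(T^d; ℝ^d) | ‖w‖ ≤ B ∧ ‖∇w‖₂² ≤ G}`

(spectral enstrophy `Torus.eGradNormSq`, defined through Fourier coefficients, hence a function of the `L²`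
class) is COMPACT in the norm topology of `L²(T^d; ℝ^d)` — the tree's Rellich lemma
`Literature.Analysis.FluidPDE.Torus.isCompact_setOf_eGradNormSq_le` for the energy space `H = L²_σ(T^d)`
with the solenoidal / mean-zero restriction removed: the Poincaré bound on the low modes is replaced by the
norm bound `‖w‖ ≤ B`, which also controls the zero mode `k = 0`.  It is consumed by SC-CMP as the compact
target of an Arzelà–Ascoli extraction in `C([0,S]; L²(T²; ℝ²))`.

Proof (the tree's, verbatim on plain `Lp`): `K` is closed — the norm ball is closed
(`isClosed_le continuous_norm continuous_const`) and `w ↦ ‖∇w‖₂²` is lower semicontinuous on `L²`, a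
supremum of finite sums of the continuous `w ↦ |k|² ‖ŵ(k)‖²` (`lowerSemicontinuous_eGradNormSq_Lp`) —,
hence complete in the Hilbert space `L²`; and totally bounded: for `N ≥ 1` and `S ⊇ {|k|² ≤ N}` the tree's
low/high splitting `Torus.enorm_sq_le_sum_add_eGradNormSq_div` and `Torus.eGradNormSq_coe_sub_le` give
`‖u − v‖² ≤ ∑_{k ∈ S} ‖û(k) − v̂(k)‖² + 4G/N` on `K` (`dist_sq_le_sum_add_of_eGradNormSq_le_Lp`), the
low modes `(ŵ(k))_{k ∈ S}` of `w ∈ K` lie in the closed ball of radius `B` of the finite-dimensional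
`ℓ²(S; ℂ^d)` (Parseval, `sum_sq_norm_mFourierCoeff_complexify_le_norm_sq`), which is compact, and
`Metric.totallyBounded_of_finite_discretization` assembles the two
(`isCompact_setOf_norm_le_and_eGradNormSq_le`, any finite index type `d`).

* `stub_scRellichLp` — the registered stub (last declaration), `d = Fin 2`.  Supports
  stmt-AnomalousDissipation-0206.

## Mathlib / Literature search

`lean search 'Rellich'`, `'isCompact_setOf_eGradNormSq'`, `'LowerSemicontinuous'` (FluidPDE /
FunctionSpaces files): the only torus Rellich lemma in the tree is the energy-space one of
`EnergySpaceRellich` (subtype `Torus.energySpace d`); its plain-`Lp` lemmas `Torus.eGradNormSq_coe_sub_le`,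
`Torus.enorm_sq_le_sum_add_eGradNormSq_div`, `Torus.finite_setOf_freqNormSq_le` and the `L²` Fourier API
of `StatisticalSolutionProofs` (`Torus.continuous_mFourierCoeff_complexify_coe`,
`Torus.mFourierCoeff_complexify_coe_sub`, `Torus.integral_norm_sq_coe_eq`) are reused; the subtype-only
steps (`Torus.lowerSemicontinuous_eGradNormSq_coe`, `Torus.dist_sq_le_sum_add_of_eGradNormSq_le`, the
Poincaré low-mode bound `Torus.norm_sq_le_of_eGradNormSq_le`) are re-proved here on `Lp` (the last one
replaced by the norm bound).  Mathlib has no Rellich–Kondrachov theorem.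

## References

* C. Foias, O. Manley, R. Rosa, R. Temam, *Navier–Stokes Equations and Turbulence*, CUP 2001,
  Ch. I §4 (4.29) (Rellich lemma), Ch. II §6. [`FMRT2001`]
-/

noncomputable section

namespace Summit.AnomalousDissipation.AnomalousDissipation.Theorems.TwohalfdThesis.SobolevCondensate

open MeasureTheory Filter Topology Set Function UnitAddTorus
open scoped ENNReal NNReal InnerProductSpace
open Literature.Analysis.FunctionSpaces Literature.Analysis.FluidPDE

set_option linter.dupNamespace false -- the registry path `AnomalousDissipation.AnomalousDissipation`

section GeneralTorus

variable {d : Type*} [Fintype d]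

/-! ### Closedness: lower semicontinuity of the enstrophy on `L²` -/

/-- The spectral enstrophy `w ↦ ‖∇w‖₂² = 4π² ∑ₖ |k|² ‖ŵ(k)‖² ∈ [0, ∞]` is lower semicontinuous on
the whole of `L²(T^d; ℝ^d)` (norm topology): the series is the supremum of its finite partial sums,
each a continuous function of `w` (`Torus.continuous_mFourierCoeff_complexify_coe`; Fatou for series —
the tree's `Torus.lowerSemicontinuous_eGradNormSq_coe` without the restriction to the energy space).
[folklore] -/
theorem lowerSemicontinuous_eGradNormSq_Lp :
    LowerSemicontinuous fun w : Lp (EuclideanSpace ℝ d) 2 (volume : Measure (UnitAddTorus d)) =>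
      Torus.eGradNormSq (w : UnitAddTorus d → EuclideanSpace ℝ d) := by
  have h : (fun w : Lp (EuclideanSpace ℝ d) 2 (volume : Measure (UnitAddTorus d)) =>
      Torus.eGradNormSq (w : UnitAddTorus d → EuclideanSpace ℝ d)) =
      (fun x => ENNReal.ofReal (4 * Real.pi ^ 2) * x) ∘
        fun w : Lp (EuclideanSpace ℝ d) 2 (volume : Measure (UnitAddTorus d)) =>
          ⨆ s : Finset (d → ℤ), ∑ k ∈ s, ENNReal.ofReal (Torus.freqNormSq k) *
            ‖mFourierCoeff
              (EuclideanSpace.complexify ∘ (w : UnitAddTorus d → EuclideanSpace ℝ d)) k‖ₑ ^ 2 := by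
    funext w
    simp only [Function.comp_apply]
    rw [Torus.eGradNormSq_eq_tsum, ENNReal.tsum_eq_iSup_sum]
  rw [h]
  refine (ENNReal.continuous_const_mul ENNReal.ofReal_ne_top).comp_lowerSemicontinuous
    (lowerSemicontinuous_iSup fun s => Continuous.lowerSemicontinuous ?_)
    fun a b hab => by dsimp only; gcongr
  refine continuous_finsetSum s fun k _ => ?_
  exact (ENNReal.continuous_const_mul ENNReal.ofReal_ne_top).comp
    ((ENNReal.continuous_pow 2).comp (Torus.continuous_mFourierCoeff_complexify_coe k).enorm)

/-- The norm-and-enstrophy balls `{w ∈ L² | ‖w‖ ≤ B ∧ ‖∇w‖₂² ≤ R}` are closed in `L²(T^d; ℝ^d)`: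
the intersection of a closed norm ball with a sublevel set of the lower semicontinuous enstrophy.
[folklore] -/
theorem isClosed_setOf_norm_le_and_eGradNormSq_le (B : ℝ) (R : ℝ≥0∞) :
    IsClosed {w : Lp (EuclideanSpace ℝ d) 2 (volume : Measure (UnitAddTorus d)) |
      ‖w‖ ≤ B ∧ Torus.eGradNormSq (w : UnitAddTorus d → EuclideanSpace ℝ d) ≤ R} :=
  (isClosed_le continuous_norm continuous_const).inter
    (lowerSemicontinuous_eGradNormSq_Lp.isClosed_preimage R)

/-! ### The quantitative Rellich estimate on plain `L²` -/

/-- **Distance control by low modes on an enstrophy ball of `L²`**: for `u, v ∈ L²(T^d; ℝ^d)` with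
`‖∇u‖₂², ‖∇v‖₂² ≤ R < ∞`, `N ≥ 1` and `S ⊇ {k : |k|² ≤ N}`,
`‖u − v‖² ≤ ∑_{k ∈ S} ‖û(k) − v̂(k)‖² + 4R/N` (the tree's tail estimate
`Torus.enorm_sq_le_sum_add_eGradNormSq_div` for `w = u − v` and
`‖∇(u − v)‖₂² ≤ 2‖∇u‖₂² + 2‖∇v‖₂²`, `Torus.eGradNormSq_coe_sub_le`; FMRT 2001, Ch. II §6 — the
tree's `Torus.dist_sq_le_sum_add_of_eGradNormSq_le` without the energy-space restriction).
[folklore] -/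
theorem dist_sq_le_sum_add_of_eGradNormSq_le_Lp {R : ℝ≥0∞} (hR : R ≠ ∞)
    {u v : Lp (EuclideanSpace ℝ d) 2 (volume : Measure (UnitAddTorus d))}
    (hu : Torus.eGradNormSq (u : UnitAddTorus d → EuclideanSpace ℝ d) ≤ R)
    (hv : Torus.eGradNormSq (v : UnitAddTorus d → EuclideanSpace ℝ d) ≤ R)
    {N : ℕ} (hN : 0 < N) (S : Finset (d → ℤ)) (hS : ∀ k, Torus.freqNormSq k ≤ N → k ∈ S) :
    dist u v ^ 2 ≤ (∑ k ∈ S,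
        ‖mFourierCoeff (EuclideanSpace.complexify ∘ (u : UnitAddTorus d → EuclideanSpace ℝ d)) k -
          mFourierCoeff
            (EuclideanSpace.complexify ∘ (v : UnitAddTorus d → EuclideanSpace ℝ d)) k‖ ^ 2) +
      4 * R.toReal / N := by
  -- abbreviate the low-mode differences
  set D : (d → ℤ) → EuclideanSpace ℂ d := fun k =>
    mFourierCoeff (EuclideanSpace.complexify ∘ (u : UnitAddTorus d → EuclideanSpace ℝ d)) k -
      mFourierCoeff (EuclideanSpace.complexify ∘ (v : UnitAddTorus d → EuclideanSpace ℝ d)) k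
    with hD
  have h1 := Torus.enorm_sq_le_sum_add_eGradNormSq_div (u - v) hN S hS
  simp only [Torus.mFourierCoeff_complexify_coe_sub] at h1
  have h2 : Torus.eGradNormSq
      ((u - v : Lp (EuclideanSpace ℝ d) 2 (volume : Measure (UnitAddTorus d))) :
        UnitAddTorus d → EuclideanSpace ℝ d) ≤ 2 * R + 2 * R :=
    (Torus.eGradNormSq_coe_sub_le _ _).trans (by gcongr)
  have h3 : ‖u - v‖ₑ ^ 2 ≤ (∑ k ∈ S, ‖D k‖ₑ ^ 2) + (2 * R + 2 * R) / N := h1.trans (by gcongr)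
  -- convert to real numbers
  have eL : ‖u - v‖ₑ ^ 2 = ENNReal.ofReal (dist u v ^ 2) := by
    rw [dist_eq_norm, ← ofReal_norm, ENNReal.ofReal_pow (norm_nonneg _)]
  have eS : (∑ k ∈ S, ‖D k‖ₑ ^ 2) = ENNReal.ofReal (∑ k ∈ S, ‖D k‖ ^ 2) := by
    rw [ENNReal.ofReal_sum_of_nonneg fun k _ => sq_nonneg _]
    exact Finset.sum_congr rfl fun k _ => by rw [← ofReal_norm, ENNReal.ofReal_pow (norm_nonneg _)]
  have eR : (2 * R + 2 * R) / N = ENNReal.ofReal (4 * R.toReal / N) := by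
    rw [ENNReal.ofReal_div_of_pos (by exact_mod_cast hN), ENNReal.ofReal_mul (by norm_num),
      ENNReal.ofReal_toReal hR, ENNReal.ofReal_natCast, ENNReal.ofReal_ofNat]
    congr 1
    ring
  rw [eL, eS, eR, ← ENNReal.ofReal_add (Finset.sum_nonneg fun k _ => sq_nonneg _)
    (by positivity)] at h3
  exact (ENNReal.ofReal_le_ofReal_iff (add_nonneg (Finset.sum_nonneg fun k _ => sq_nonneg _)
    (by positivity))).1 h3

/-- **Low modes are bounded by the norm** (one side of Parseval): for `w ∈ L²(T^d; ℝ^d)` and a finite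
set of frequencies `S`, `∑_{k ∈ S} ‖ŵ(k)‖² ≤ ‖w‖²` (`Torus.hasSum_sq_norm_mFourierCoeff_complexify`;
this replaces the Poincaré bound of the energy-space version and also controls the zero mode).
[folklore] -/
theorem sum_sq_norm_mFourierCoeff_complexify_le_norm_sq
    (w : Lp (EuclideanSpace ℝ d) 2 (volume : Measure (UnitAddTorus d))) (S : Finset (d → ℤ)) :
    ∑ k ∈ S,
        ‖mFourierCoeff (EuclideanSpace.complexify ∘ (w : UnitAddTorus d → EuclideanSpace ℝ d)) k‖ ^ 2 ≤
      ‖w‖ ^ 2 := by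
  have hsum := Torus.hasSum_sq_norm_mFourierCoeff_complexify (Lp.memLp w)
  rw [Torus.integral_norm_sq_coe_eq] at hsum
  exact sum_le_hasSum S (fun k _ => sq_nonneg _) hsum

/-! ### Compactness -/

/-- **Rellich's lemma on plain `L²(T^d; ℝ^d)`.** For `B ∈ ℝ` and `R < ∞` the norm-and-enstrophy
ball `{w ∈ L²(T^d; ℝ^d) | ‖w‖ ≤ B ∧ ‖∇w‖₂² ≤ R}` is compact in the norm topology of `L²`
(compactness of the embedding `H¹(T^d) ⊂ L²(T^d)`; Foias–Manley–Rosa–Temam 2001, Ch. I §4 (4.29)).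
Proof: closed (closed ball ∩ sublevel set of the lower semicontinuous enstrophy) and complete; totally
bounded by the low/high mode splitting `‖u − v‖² ≤ ∑_{|k|² ≤ N} ‖û(k) − v̂(k)‖² + 4R/N` and
compactness of the closed ball of radius `B` in the finite-dimensional space `ℓ²(S; ℂ^d)` of low modes
(`Metric.totallyBounded_of_finite_discretization`). [cite: FMRT2001, Ch. I §4 (4.29)] -/
theorem isCompact_setOf_norm_le_and_eGradNormSq_le (B : ℝ) {R : ℝ≥0∞} (hR : R ≠ ∞) :
    IsCompact {w : Lp (EuclideanSpace ℝ d) 2 (volume : Measure (UnitAddTorus d)) |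
      ‖w‖ ≤ B ∧ Torus.eGradNormSq (w : UnitAddTorus d → EuclideanSpace ℝ d) ≤ R} := by
  set K := {w : Lp (EuclideanSpace ℝ d) 2 (volume : Measure (UnitAddTorus d)) |
    ‖w‖ ≤ B ∧ Torus.eGradNormSq (w : UnitAddTorus d → EuclideanSpace ℝ d) ≤ R} with hK
  -- the Fourier coefficient maps on `L²`
  set c : Lp (EuclideanSpace ℝ d) 2 (volume : Measure (UnitAddTorus d)) → (d → ℤ) →
      EuclideanSpace ℂ d := fun w k =>
    mFourierCoeff (EuclideanSpace.complexify ∘ (w : UnitAddTorus d → EuclideanSpace ℝ d)) k with hc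
  rw [isCompact_iff_totallyBounded_isComplete]
  refine ⟨?_, (isClosed_setOf_norm_le_and_eGradNormSq_le B R).isComplete⟩
  refine Metric.totallyBounded_of_finite_discretization fun ε hε => ?_
  set r : ℝ := R.toReal with hr
  have hr0 : 0 ≤ r := ENNReal.toReal_nonneg
  -- frequency cutoff `N` with `4 r / N ≤ ε² / 4`
  obtain ⟨N, hN⟩ := exists_nat_gt (16 * r / ε ^ 2)
  have hNpos : 0 < N := Nat.cast_pos.1 ((by positivity : (0 : ℝ) ≤ 16 * r / ε ^ 2).trans_lt hN)
  have htail : 4 * r / N ≤ ε ^ 2 / 4 := by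
    rw [div_le_iff₀ (by exact_mod_cast hNpos : (0 : ℝ) < N)]
    rw [div_lt_iff₀ (by positivity)] at hN
    nlinarith
  -- the finite set of low frequencies
  obtain ⟨S, hS'⟩ : ∃ S : Finset (d → ℤ), ∀ k, Torus.freqNormSq k ≤ N → k ∈ S :=
    ⟨(Torus.finite_setOf_freqNormSq_le N).toFinset, fun k hk =>
      (Torus.finite_setOf_freqNormSq_le N).mem_toFinset.2 hk⟩
  -- the low-mode map into a finite-dimensional space
  let P : Lp (EuclideanSpace ℝ d) 2 (volume : Measure (UnitAddTorus d)) →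
      PiLp 2 (fun _ : ↥S => EuclideanSpace ℂ d) := fun w => WithLp.toLp 2 fun k => c w k
  have hPsub : ∀ u v, dist (P u) (P v) ^ 2 = ∑ k ∈ S, ‖c u k - c v k‖ ^ 2 := by
    intro u v
    rw [dist_eq_norm, PiLp.norm_sq_eq_of_L2]
    simp only [P, PiLp.sub_apply]
    exact Finset.sum_coe_sort S fun k => ‖c u k - c v k‖ ^ 2
  have hPbound : ∀ w ∈ K, ‖P w‖ ≤ B := by
    intro w hw
    have h1 : ‖P w‖ ^ 2 ≤ ‖w‖ ^ 2 := by
      rw [PiLp.norm_sq_eq_of_L2]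
      simp only [P]
      rw [Finset.sum_coe_sort S fun k => ‖c w k‖ ^ 2]
      exact sum_sq_norm_mFourierCoeff_complexify_le_norm_sq w S
    exact ((pow_le_pow_iff_left₀ (norm_nonneg _) (norm_nonneg _) two_ne_zero).1 h1).trans hw.1
  -- the image of `K` is totally bounded: pick a finite `ε/4`-net
  have htb : TotallyBounded (P '' K) :=
    (isCompact_closedBall (0 : PiLp 2 (fun _ : ↥S => EuclideanSpace ℂ d)) B).totallyBounded.subset
      (by
        rintro _ ⟨w, hw, rfl⟩
        exact mem_closedBall_zero_iff.2 (hPbound w hw))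
  obtain ⟨t, htfin, hcover⟩ := Metric.totallyBounded_iff.1 htb (ε / 4) (by positivity)
  haveI : Fintype t := htfin.fintype
  have hchoice : ∀ x : K, ∃ y : t, dist (P x) y < ε / 4 := fun x => by
    have hx := hcover ⟨x, x.2, rfl⟩
    simp only [Set.mem_iUnion, Metric.mem_ball, exists_prop] at hx
    obtain ⟨y, hy, hxy⟩ := hx
    exact ⟨⟨y, hy⟩, hxy⟩
  choose F hF using hchoice
  refine ⟨t, inferInstance, F, fun x y hxy => ?_⟩
  have hP : dist (P x) (P y) < ε / 2 :=
    calc dist (P x) (P y) ≤ dist (P x) (F x) + dist (P y) (F x) := dist_triangle_right _ _ _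
      _ < ε / 4 + ε / 4 := by
          refine add_lt_add (hF x) ?_
          rw [hxy]
          exact hF y
      _ = ε / 2 := by ring
  have hkey := dist_sq_le_sum_add_of_eGradNormSq_le_Lp hR x.2.2 y.2.2 hNpos S hS'
  rw [← hPsub] at hkey
  have hP2 : dist (P x) (P y) ^ 2 < (ε / 2) ^ 2 := pow_lt_pow_left₀ hP dist_nonneg two_ne_zero
  have hlt : dist (x : Lp (EuclideanSpace ℝ d) 2 (volume : Measure (UnitAddTorus d))) y ^ 2 <
      ε ^ 2 := by
    nlinarith
  exact lt_of_pow_lt_pow_left₀ 2 hε.le hlt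

end GeneralTorus

/-- **SC-RL `stub_scRellichLp` — Rellich on `L²(T²; ℝ²)` (registered stub).**  The set of `L²` classes
with norm `≤ B` and spectral enstrophy `≤ G` is compact in `L²(T²; ℝ²)` (closed: the norm ball is closed
and `eGradNormSq` is lower semicontinuous on `L²`; totally bounded: low/high Fourier splitting
`‖u − v‖² ≤ ∑_{|k|²≤N} ‖û(k) − v̂(k)‖² + 4G/N` and total boundedness of bounded sets of low modes —
the tree's `EnergySpaceRellich` without the solenoidal/mean-zero restriction,
`isCompact_setOf_norm_le_and_eGradNormSq_le` at `d = Fin 2`, `R = G < ∞`).  Leans on: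
`Literature.Analysis.FluidPDE.Torus.enorm_sq_le_sum_add_eGradNormSq_div`, `…eGradNormSq_coe_sub_le`
(FMRT 2001, Ch. I §4 (4.29)). [cite: FMRT2001, Ch. I §4 (4.29)] -/
theorem stub_scRellichLp :
    ∀ (B : ℝ) (G : ℝ≥0),
      IsCompact {w : Lp (EuclideanSpace ℝ (Fin 2)) 2 (volume : Measure (UnitAddTorus (Fin 2))) |
        ‖w‖ ≤ B ∧ Torus.eGradNormSq (w : UnitAddTorus (Fin 2) → EuclideanSpace ℝ (Fin 2)) ≤ G} :=
  fun B G => isCompact_setOf_norm_le_and_eGradNormSq_le (R := G) B ENNReal.coe_ne_top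

end Summit.AnomalousDissipation.AnomalousDissipation.Theorems.TwohalfdThesis.SobolevCondensate
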